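import Literature.Topology.FourManifolds.TorusCurveTubes
import Mathlib.Analysis.SpecialFunctions.SmoothTransition
import HarnessLib

/-!
# Smooth bumps on the torus localised at a point, and compact coordinate discs

Topic `Literature/Topology/FourManifolds` (fact seat of the Seiberg–Witten leaf
`Literature.Barriers.SmoothPoincare4.akhmedovPark2010_lemma8_invariants`; block 2 of
Akhmedov–Park's `X₁(m)`, A. Akhmedov, B. D. Park, Invent. Math. 181 (2010), §3).  Two small
tools for localising the framing corrections (`FramingPhaseCorrection.lean`,
`FramingRadialExtension.lean`) near the plumbing points of the two parameter tori of `Σ̄₂`: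

* `exists_torusBump` — on the torus `T = Rechart f (S¹ × S¹)`, for a point `θ = (θ₁, θ₂)` and
  levels `c_out < c_in`, a smooth `β : T → [0, 1]` with `β = 1` where both `Re (zᵢ θᵢ⁻¹) ≥ c_in`,
  `β = 0` where some `Re (zᵢ θᵢ⁻¹) ≤ c_out`, and `tsupport β ⊆ {Re (z₁ θ₁⁻¹) ≥ c_out ∧ Re (z₂ θ₂⁻¹) ≥ c_out}`
  (product of two smooth transitions of the real parts);
* `isCompact_chartDisc` — for a chart `e` with full target onto a proper space, the coordinate
  disc `{x ∈ e.source | ‖e x - v‖ ≤ R}` is `e⁻¹` of a closed ball, hence compact (and closed).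

Everything is proved; no definitions.

## References

* A. Akhmedov, B. D. Park, Invent. Math. 181 (2010) 577–603 = arXiv:math/0701829, §3. [AkhmedovPark2010]
-/

noncomputable section

open scoped Manifold ContDiff Topology
open Set Function
open Literature.Geometry.Manifold (Rechart)

namespace Literature.Topology.FourManifolds

/-! ### Compact coordinate discs -/

section ChartDisc

variable {M : Type*} [TopologicalSpace M] {E' : Type*} [NormedAddCommGroup E'] [ProperSpace E']

/-- **A coordinate disc of a chart with full target is compact**: `{x ∈ e.source | ‖e x - v‖ ≤ R}`
is the image of the closed ball under `e⁻¹`. [folklore] -/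
theorem isCompact_chartDisc (e : OpenPartialHomeomorph M E') (he : e.target = univ) (v : E') (R : ℝ) :
    IsCompact {x | x ∈ e.source ∧ ‖e x - v‖ ≤ R} := by
  have heq : {x | x ∈ e.source ∧ ‖e x - v‖ ≤ R} = e.symm '' Metric.closedBall v R := by
    ext x
    constructor
    · rintro ⟨hx, hR⟩
      refine ⟨e x, ?_, e.left_inv hx⟩
      rwa [Metric.mem_closedBall, dist_eq_norm]
    · rintro ⟨y, hy, rfl⟩
      have hy' : y ∈ e.target := by rw [he]; exact mem_univ y
      refine ⟨e.map_target hy', ?_⟩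
      rw [e.right_inv hy']
      rwa [Metric.mem_closedBall, dist_eq_norm] at hy
  rw [heq]
  refine (isCompact_closedBall v R).image_of_continuousOn (e.continuousOn_symm.mono ?_)
  rw [he]; exact subset_univ _

/-- The coordinate disc is closed (Hausdorff `M`). [folklore] -/
theorem isClosed_chartDisc [T2Space M] (e : OpenPartialHomeomorph M E') (he : e.target = univ)
    (v : E') (R : ℝ) : IsClosed {x | x ∈ e.source ∧ ‖e x - v‖ ≤ R} :=
  (isCompact_chartDisc e he v R).isClosed

end ChartDisc

/-! ### Product bumps on the torus -/

section TorusBump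

variable {f : ModelProd (EuclideanSpace ℝ (Fin 1)) (EuclideanSpace ℝ (Fin 1)) ≃ₜ EuclideanSpace ℝ (Fin 2)}

/-- The real part of `z θ⁻¹` is a smooth function on the recharted torus, in each factor.
[folklore] -/
theorem contMDiff_re_mul_inv (hf : ContMDiff ((𝓡 1).prod (𝓡 1)) 𝓘(ℝ, EuclideanSpace ℝ (Fin 2)) ∞ f)
    (hf' : ContMDiff 𝓘(ℝ, EuclideanSpace ℝ (Fin 2)) ((𝓡 1).prod (𝓡 1)) ∞ f.symm) (θ₁ θ₂ : Circle) :
    ContMDiff (𝓡 2) 𝓘(ℝ, ℝ) ∞ (fun w : Rechart f (Circle × Circle) =>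
      ((((Rechart.out f (Circle × Circle) w).1 * θ₁⁻¹ : Circle)) : ℂ).re) ∧
    ContMDiff (𝓡 2) 𝓘(ℝ, ℝ) ∞ (fun w : Rechart f (Circle × Circle) =>
      ((((Rechart.out f (Circle × Circle) w).2 * θ₂⁻¹ : Circle)) : ℂ).re) := by
  haveI hT : IsManifold (𝓡 2) ∞ (Rechart f (Circle × Circle)) := Rechart.isManifold f _ hf hf'
  haveI : Fact (Module.finrank ℝ ℂ = 1 + 1) := finrank_real_complex_fact'
  have hout : ContMDiff (𝓡 2) ((𝓡 1).prod (𝓡 1)) ∞ (Rechart.out f (Circle × Circle)) :=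
    Rechart.contMDiff_out f _ hf hf'
  have hcoe : ContMDiff (𝓡 1) 𝓘(ℝ, ℂ) ∞ (fun z : Circle => (z : ℂ)) := contMDiff_coe_sphere
  have hre : ContMDiff 𝓘(ℝ, ℂ) 𝓘(ℝ, ℝ) ∞ (fun z : ℂ => z.re) := Complex.reCLM.contMDiff
  constructor
  · have h1 : ContMDiff (𝓡 2) (𝓡 1) ∞ fun w : Rechart f (Circle × Circle) =>
        (Rechart.out f (Circle × Circle) w).1 * θ₁⁻¹ :=
      (contMDiff_fst.comp hout).mul contMDiff_const
    exact hre.comp (hcoe.comp h1)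
  · have h2 : ContMDiff (𝓡 2) (𝓡 1) ∞ fun w : Rechart f (Circle × Circle) =>
        (Rechart.out f (Circle × Circle) w).2 * θ₂⁻¹ :=
      (contMDiff_snd.comp hout).mul contMDiff_const
    exact hre.comp (hcoe.comp h2)

/-- **Smooth product bump on the torus localised at `(θ₁, θ₂)`.**  For `c_out < c_in` there is a
smooth `β : T → [0, 1]` with `β = 1` where `Re (z₁ θ₁⁻¹) ≥ c_in` and `Re (z₂ θ₂⁻¹) ≥ c_in`, `β = 0`
where `Re (z₁ θ₁⁻¹) ≤ c_out` or `Re (z₂ θ₂⁻¹) ≤ c_out`, and support in the closed box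
`{Re (z₁ θ₁⁻¹) ≥ c_out ∧ Re (z₂ θ₂⁻¹) ≥ c_out}`. [folklore] -/
theorem exists_torusBump (hf : ContMDiff ((𝓡 1).prod (𝓡 1)) 𝓘(ℝ, EuclideanSpace ℝ (Fin 2)) ∞ f)
    (hf' : ContMDiff 𝓘(ℝ, EuclideanSpace ℝ (Fin 2)) ((𝓡 1).prod (𝓡 1)) ∞ f.symm) (θ₁ θ₂ : Circle)
    {cin cout : ℝ} (hc : cout < cin) :
    ∃ β : Rechart f (Circle × Circle) → ℝ,
      ContMDiff (𝓡 2) 𝓘(ℝ, ℝ) ∞ β ∧ (∀ w, 0 ≤ β w ∧ β w ≤ 1) ∧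
      (∀ w, cin ≤ ((((Rechart.out f (Circle × Circle) w).1 * θ₁⁻¹ : Circle)) : ℂ).re →
        cin ≤ ((((Rechart.out f (Circle × Circle) w).2 * θ₂⁻¹ : Circle)) : ℂ).re → β w = 1) ∧
      (∀ w, (((((Rechart.out f (Circle × Circle) w).1 * θ₁⁻¹ : Circle)) : ℂ).re ≤ cout ∨
        ((((Rechart.out f (Circle × Circle) w).2 * θ₂⁻¹ : Circle)) : ℂ).re ≤ cout) → β w = 0) ∧
      tsupport β ⊆ {w | cout ≤ ((((Rechart.out f (Circle × Circle) w).1 * θ₁⁻¹ : Circle)) : ℂ).re ∧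
        cout ≤ ((((Rechart.out f (Circle × Circle) w).2 * θ₂⁻¹ : Circle)) : ℂ).re} := by
  obtain ⟨hr1, hr2⟩ := contMDiff_re_mul_inv hf hf' θ₁ θ₂
  set r₁ : Rechart f (Circle × Circle) → ℝ := fun w =>
    ((((Rechart.out f (Circle × Circle) w).1 * θ₁⁻¹ : Circle)) : ℂ).re with hr₁
  set r₂ : Rechart f (Circle × Circle) → ℝ := fun w =>
    ((((Rechart.out f (Circle × Circle) w).2 * θ₂⁻¹ : Circle)) : ℂ).re with hr₂
  have hd : 0 < cin - cout := by linarith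
  let S : ℝ → ℝ := fun t => Real.smoothTransition ((t - cout) / (cin - cout))
  have hS : ContDiff ℝ ∞ S :=
    Real.smoothTransition.contDiff.comp ((contDiff_id.sub contDiff_const).div_const _)
  have hS0 : ∀ t, t ≤ cout → S t = 0 := fun t ht =>
    Real.smoothTransition.zero_of_nonpos (div_nonpos_of_nonpos_of_nonneg (by linarith) hd.le)
  have hS1 : ∀ t, cin ≤ t → S t = 1 := fun t ht =>
    Real.smoothTransition.one_of_one_le ((one_le_div hd).2 (by linarith))
  have hS01 : ∀ t, 0 ≤ S t ∧ S t ≤ 1 := fun t =>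
    ⟨Real.smoothTransition.nonneg _, Real.smoothTransition.le_one _⟩
  let β : Rechart f (Circle × Circle) → ℝ := fun w => S (r₁ w) * S (r₂ w)
  have hβsm : ContMDiff (𝓡 2) 𝓘(ℝ, ℝ) ∞ β :=
    contDiff_mul.comp_contMDiff ((hS.comp_contMDiff hr1).prodMk_space (hS.comp_contMDiff hr2))
  refine ⟨β, hβsm, fun w => ?_, fun w h1 h2 => ?_, fun w h => ?_, ?_⟩
  · obtain ⟨a0, a1⟩ := hS01 (r₁ w)
    obtain ⟨b0, b1⟩ := hS01 (r₂ w)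
    exact ⟨mul_nonneg a0 b0, mul_le_one₀ a1 b0 b1⟩
  · show S (r₁ w) * S (r₂ w) = 1
    rw [hS1 _ h1, hS1 _ h2, one_mul]
  · show S (r₁ w) * S (r₂ w) = 0
    rcases h with h | h
    · rw [hS0 _ h, zero_mul]
    · rw [hS0 _ h, mul_zero]
  · -- the support lies in the open box `{r₁ > cout ∧ r₂ > cout}`, inside the closed box
    have hsupp : support β ⊆ {w | cout ≤ r₁ w ∧ cout ≤ r₂ w} := by
      intro w hw
      rw [mem_support] at hw
      constructor
      · by_contra h
        exact hw (by show S (r₁ w) * S (r₂ w) = 0; rw [hS0 _ (le_of_not_ge h), zero_mul])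
      · by_contra h
        exact hw (by show S (r₁ w) * S (r₂ w) = 0; rw [hS0 _ (le_of_not_ge h), mul_zero])
    have hclosed : IsClosed {w | cout ≤ r₁ w ∧ cout ≤ r₂ w} :=
      (isClosed_le continuous_const hr1.continuous).inter (isClosed_le continuous_const hr2.continuous)
    exact closure_minimal hsupp hclosed

end TorusBump

end Literature.Topology.FourManifolds
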